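import Summits.Ventures.PercRepro.RankLevelSetM

/-!
# PercRepro — THE LYM-DEFICIT OF A MATROID COMPLEX IS CONTRACTION-MONOTONE (night-1, gen 8; Theorem (a_p))

`indepSets M u` (p3, RankLevelSetM) are the independent `u`-subsets of the ground set, `i_u := (indepSets M u).card`.
Theorem M's hereditary bound `C(n,u)·i_p ≤ C(n,p)·i_u` (`choose_mul_card_indepSets_le`) has an EXACT defect:

* **`card_indepSets_mul_choose_add_sum_depCount`** (Lemma 1) — for `u ≤ p`,
  `i_u · C(n−u, p−u) = i_p · C(p, u) + Σ_{Z ∈ I_u} dep_p(Z)`, where `depCount M p Z` = the number of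
  `p`-subsets of `E` containing `Z` that are DEPENDENT (double count of the independent pairs `Z ⊆ X`);
* **`sum_depCount_contract`** — for a non-loop `e` and `1 ≤ u`, the part of that sum over the `Z ∋ e` is EXACTLY
  the same sum for `M ／ {e}` one level down: `Σ_{Z ∈ I_u(M), e ∈ Z} dep_p(Z) = Σ_{Z' ∈ I_{u−1}(M／e)} dep_{p−1}(Z')`
  (`Z = insert e Z'`, `X = insert e W`);
* **`deficit_contract_le`** (Theorem (a_p), termwise) — for a non-loop `e` and `1 ≤ u ≤ p ≤ n`,
  `i_{u−1}(M／e) − C(n−1,u−1)/C(n−1,p−1) · i_{p−1}(M／e) ≤ i_u(M) − C(n,u)/C(n,p) · i_p(M)`: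
  the LYM-deficit of the independence complex at level `u` dominates the deficit of the link of `e` one level down;
* **`indepSlack_contract_le`** — summed over `q < u < p`: the pure independent-set slack
  `τ′_M(p, q) = Σ_{q<u<p} i_u − Φ_n(p,q)·i_p` (`Φ_n(p,q) = Σ_{q<u<p} C(n,u)/C(n,p)`, `= Φ(p,q)` at `n = p + q`)
  satisfies `τ′_{M／e}(p−1, q) ≤ τ′_M(p, q)` — the contraction monotonicity (MC) of the lane, for the
  independent-set slack, at EVERY non-loop of EVERY finite matroid, with no restriction.

Paper: proofs/NIGHT-1-C025-induction.md §18.6.  Axioms: standard.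
-/

namespace PercRepro

open Set Matroid Finset
open scoped Classical

variable {α : Type} (M : Matroid α) [M.Finite]

/-- `dep_p(Z)`: the number of `p`-subsets `X` of `E` with `Z ⊆ X` that are dependent. -/
noncomputable def depCount (p : ℕ) (Z : Finset α) : ℕ :=
  (((M.set_finite M.E).toFinset.powersetCard p).filter
    (fun X => Z ⊆ X ∧ ¬ M.Indep (X : Set α))).card

/-- The `p`-subsets of `E` containing a given `u`-subset `Z ⊆ E` number `C(n−u, p−u)`
(`T ↦ Z ∪ T` from the `(p−u)`-subsets of `E ∖ Z`). -/
lemma card_powersetCard_filter_subset {Ef Z : Finset α} (hZ : Z ⊆ Ef) {u p : ℕ} (hZu : Z.card = u)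
    (hup : u ≤ p) :
    ((Ef.powersetCard p).filter (fun X => Z ⊆ X)).card = (Ef.card - u).choose (p - u) := by
  have himg : (Ef.powersetCard p).filter (fun X => Z ⊆ X) =
      ((Ef \ Z).powersetCard (p - u)).image (fun T => Z ∪ T) := by
    ext X
    simp only [Finset.mem_filter, Finset.mem_powersetCard, Finset.mem_image]
    constructor
    · rintro ⟨⟨hXE, hXp⟩, hZX⟩
      refine ⟨X \ Z, ⟨?_, ?_⟩, ?_⟩
      · exact Finset.sdiff_subset_sdiff hXE (Finset.Subset.refl _)
      · rw [Finset.card_sdiff_of_subset hZX, hXp, hZu]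
      · rw [Finset.union_sdiff_of_subset hZX]
    · rintro ⟨T, ⟨hTE, hTcard⟩, rfl⟩
      have hdisj : Disjoint Z T := by
        rw [Finset.disjoint_left]
        intro x hxZ hxT
        exact (Finset.mem_sdiff.1 (hTE hxT)).2 hxZ
      refine ⟨⟨?_, ?_⟩, Finset.subset_union_left⟩
      · exact Finset.union_subset hZ (hTE.trans Finset.sdiff_subset)
      · rw [Finset.card_union_of_disjoint hdisj, hZu, hTcard]
        omega
  rw [himg, Finset.card_image_of_injOn, Finset.card_powersetCard, Finset.card_sdiff_of_subset hZ, hZu]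
  intro T hT T' hT' hEq
  rw [Finset.mem_coe, Finset.mem_powersetCard] at hT hT'
  have h1 : Disjoint Z T := by
    rw [Finset.disjoint_left]; intro x hxZ hxT; exact (Finset.mem_sdiff.1 (hT.1 hxT)).2 hxZ
  have h2 : Disjoint Z T' := by
    rw [Finset.disjoint_left]; intro x hxZ hxT; exact (Finset.mem_sdiff.1 (hT'.1 hxT)).2 hxZ
  have hEq' : Z ∪ T = Z ∪ T' := hEq
  have : (Z ∪ T) \ Z = (Z ∪ T') \ Z := by rw [hEq']
  rwa [Finset.union_sdiff_cancel_left h1, Finset.union_sdiff_cancel_left h2] at this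

/-- Every `u`-subset of an independent `p`-set is an independent `u`-set: `C(p, u)` of them. -/
lemma card_indepSets_filter_subset_indep {u p : ℕ} {X : Finset α} (hX : X ∈ indepSets M p) :
    ((indepSets M u).filter (fun Z => Z ⊆ X)).card = p.choose u := by
  rw [mem_indepSets M] at hX
  obtain ⟨hXE, hXp, hXind⟩ := hX
  have h : (indepSets M u).filter (fun Z => Z ⊆ X) = X.powersetCard u := by
    ext Z
    simp only [Finset.mem_filter, Finset.mem_powersetCard, mem_indepSets M]
    constructor
    · rintro ⟨⟨-, hZu, -⟩, hZX⟩
      exact ⟨hZX, hZu⟩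
    · rintro ⟨hZX, hZu⟩
      exact ⟨⟨hZX.trans hXE, hZu, hXind.subset (by exact_mod_cast hZX)⟩, hZX⟩
  rw [h, Finset.card_powersetCard, hXp]

/-- **Lemma 1 (the LYM deficit, exact)**: for `u ≤ p ≤ |E|`,
`i_u · C(n−u, p−u) = i_p · C(p, u) + Σ_{Z ∈ I_u} dep_p(Z)` — double count of the pairs `Z ⊆ X`
with `Z` an independent `u`-set and `X` a `p`-subset of `E`. -/
theorem card_indepSets_mul_choose_add_sum_depCount {u p : ℕ} (hup : u ≤ p) :
    (indepSets M u).card * (M.E.ncard - u).choose (p - u) =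
      (indepSets M p).card * p.choose u + ∑ Z ∈ indepSets M u, depCount M p Z := by
  set Ef := (M.set_finite M.E).toFinset with hEf
  have hEcard : Ef.card = M.E.ncard := (ncard_eq_toFinset_card _ (M.set_finite M.E)).symm
  -- the left side: each independent `u`-set has `C(n−u, p−u)` `p`-supersets in `E`
  have hL : (indepSets M u).card * (M.E.ncard - u).choose (p - u) =
      ∑ Z ∈ indepSets M u, ((Ef.powersetCard p).filter (fun X => Z ⊆ X)).card := by
    rw [Finset.card_eq_sum_ones, Finset.sum_mul, one_mul]
    apply Finset.sum_congr rfl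
    intro Z hZ
    rw [mem_indepSets M] at hZ
    rw [card_powersetCard_filter_subset hZ.1 hZ.2.1 hup, hEcard]
  -- split the supersets of `Z` into independent and dependent
  have hsplit : ∀ Z ∈ indepSets M u, ((Ef.powersetCard p).filter (fun X => Z ⊆ X)).card =
      ((indepSets M p).bipartiteAbove (fun (Z X : Finset α) => Z ⊆ X) Z).card + depCount M p Z := by
    intro Z _
    unfold depCount
    rw [← Finset.card_filter_add_card_filter_not (s := (Ef.powersetCard p).filter (fun X => Z ⊆ X))
      (fun X => M.Indep (X : Set α)), Finset.filter_filter, Finset.filter_filter]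
    congr 1
    · congr 1
      ext X
      simp only [Finset.mem_filter, Finset.mem_powersetCard, Finset.mem_bipartiteAbove, mem_indepSets M]
      tauto
  rw [hL, Finset.sum_congr rfl hsplit, Finset.sum_add_distrib,
    Finset.sum_card_bipartiteAbove_eq_sum_card_bipartiteBelow]
  congr 1
  rw [Finset.card_eq_sum_ones, Finset.sum_mul, one_mul]
  apply Finset.sum_congr rfl
  intro X hX
  rw [Finset.bipartiteBelow]
  exact card_indepSets_filter_subset_indep M hX



/-- The ground set of `M ／ {e}` as a `Finset`: `E.erase e`. -/
lemma toFinset_contract_ground (e : α) :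
    ((M ／ {e}).set_finite (M ／ {e}).E).toFinset = (M.set_finite M.E).toFinset.erase e := by
  ext x
  rw [Set.Finite.mem_toFinset, Finset.mem_erase, Set.Finite.mem_toFinset, Matroid.contract_ground,
    Set.mem_sdiff, Set.mem_singleton_iff]
  tauto

/-- `dep_p(insert e Z') = dep^{M／e}_{p−1}(Z')` for `Z' ⊆ E ∖ e` and a non-loop `e`
(`X ↦ X.erase e` between the dependent `p`-supersets of `insert e Z'` and the `(p−1)`-supersets of `Z'`
dependent in the contraction). -/
lemma depCount_insert_eq_depCount_contract {e : α} (he : M.IsNonloop e) {Z' : Finset α} (heZ : e ∉ Z')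
    (r : ℕ) : depCount M (r + 1) (insert e Z') = depCount (M ／ {e}) r Z' := by
  unfold depCount
  rw [toFinset_contract_ground]
  set Ef := (M.set_finite M.E).toFinset with hEf
  have heE : e ∈ Ef := by rw [hEf, Set.Finite.mem_toFinset]; exact he.mem_ground
  -- the right side is the image of the left side under `erase e`; use the inverse direction `insert e`
  have himg : (Ef.powersetCard (r + 1)).filter (fun X => insert e Z' ⊆ X ∧ ¬ M.Indep (X : Set α)) =
      (((Ef.erase e).powersetCard r).filter (fun W => Z' ⊆ W ∧ ¬ (M ／ {e}).Indep (W : Set α))).image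
        (fun W => insert e W) := by
    ext X
    simp only [Finset.mem_filter, Finset.mem_powersetCard, Finset.mem_image]
    constructor
    · rintro ⟨⟨hXE, hXcard⟩, hZX, hXdep⟩
      have heX : e ∈ X := hZX (Finset.mem_insert_self e Z')
      refine ⟨X.erase e, ⟨⟨?_, ?_⟩, ?_, ?_⟩, Finset.insert_erase heX⟩
      · exact Finset.erase_subset_erase e hXE
      · rw [Finset.card_erase_of_mem heX, hXcard]; rfl
      · intro x hx
        exact Finset.mem_erase.2 ⟨fun hxe => heZ (hxe ▸ hx), hZX (Finset.mem_insert_of_mem hx)⟩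
      · rw [he.contractElem_indep_iff]
        rintro ⟨-, hind⟩
        apply hXdep
        rw [← Finset.coe_insert, Finset.insert_erase heX] at hind
        exact hind
    · rintro ⟨W, ⟨⟨hWE, hWcard⟩, hZW, hWdep⟩, rfl⟩
      have heW : e ∉ W := fun h => (Finset.mem_erase.1 (hWE h)).1 rfl
      refine ⟨⟨?_, ?_⟩, ?_, ?_⟩
      · exact Finset.insert_subset heE (hWE.trans (Finset.erase_subset e Ef))
      · rw [Finset.card_insert_of_notMem heW, hWcard]
      · exact Finset.insert_subset_insert e hZW
      · intro hind
        apply hWdep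
        rw [he.contractElem_indep_iff]
        refine ⟨heW, ?_⟩
        rw [Finset.coe_insert] at hind
        exact hind
  rw [himg, Finset.card_image_of_injOn]
  intro W hW W' hW' hEq
  rw [Finset.mem_coe, Finset.mem_filter, Finset.mem_powersetCard] at hW hW'
  have heW : e ∉ W := fun h => (Finset.mem_erase.1 (hW.1.1 h)).1 rfl
  have heW' : e ∉ W' := fun h => (Finset.mem_erase.1 (hW'.1.1 h)).1 rfl
  have hEq' : insert e W = insert e W' := hEq
  rw [← Finset.erase_insert heW, ← Finset.erase_insert heW', hEq']

/-- **The contraction transfer**: the part of `Σ_{Z ∈ I_u(M)} dep_p(Z)` over the `Z ∋ e` is the full sum for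
`M ／ {e}` one level down (`Z = insert e Z'`). -/
theorem sum_depCount_contract {e : α} (he : M.IsNonloop e) (v r : ℕ) :
    ∑ Z ∈ (indepSets M (v + 1)).filter (fun Z => e ∈ Z), depCount M (r + 1) Z =
      ∑ Z' ∈ indepSets (M ／ {e}) v, depCount (M ／ {e}) r Z' := by
  have himg : (indepSets M (v + 1)).filter (fun Z => e ∈ Z) =
      (indepSets (M ／ {e}) v).image (fun Z' => insert e Z') := by
    ext Z
    simp only [Finset.mem_filter, Finset.mem_image, mem_indepSets M, mem_indepSets (M ／ {e}),
      toFinset_contract_ground]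
    constructor
    · rintro ⟨⟨hZE, hZcard, hZind⟩, heZ⟩
      refine ⟨Z.erase e, ⟨?_, ?_, ?_⟩, Finset.insert_erase heZ⟩
      · exact Finset.erase_subset_erase e hZE
      · rw [Finset.card_erase_of_mem heZ, hZcard]; rfl
      · rw [he.contractElem_indep_iff]
        refine ⟨Finset.notMem_erase e Z, ?_⟩
        rw [← Finset.coe_insert, Finset.insert_erase heZ]
        exact hZind
    · rintro ⟨Z', ⟨hZ'E, hZ'card, hZ'ind⟩, rfl⟩
      have heZ' : e ∉ Z' := fun h => (Finset.mem_erase.1 (hZ'E h)).1 rfl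
      rw [he.contractElem_indep_iff] at hZ'ind
      refine ⟨⟨?_, ?_, ?_⟩, Finset.mem_insert_self e Z'⟩
      · exact Finset.insert_subset (by rw [Set.Finite.mem_toFinset]; exact he.mem_ground)
          (hZ'E.trans (Finset.erase_subset e _))
      · rw [Finset.card_insert_of_notMem heZ', hZ'card]
      · rw [Finset.coe_insert]; exact hZ'ind.2
  rw [himg, Finset.sum_image]
  · apply Finset.sum_congr rfl
    intro Z' hZ'
    rw [mem_indepSets (M ／ {e}), toFinset_contract_ground] at hZ'
    have heZ' : e ∉ Z' := fun h => (Finset.mem_erase.1 (hZ'.1 h)).1 rfl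
    exact depCount_insert_eq_depCount_contract M he heZ' r
  · intro Z' hZ' Z'' hZ'' hEq
    rw [Finset.mem_coe, mem_indepSets (M ／ {e}), toFinset_contract_ground] at hZ' hZ''
    have h1 : e ∉ Z' := fun h => (Finset.mem_erase.1 (hZ'.1 h)).1 rfl
    have h2 : e ∉ Z'' := fun h => (Finset.mem_erase.1 (hZ''.1 h)).1 rfl
    have hEq' : insert e Z' = insert e Z'' := hEq
    rw [← Finset.erase_insert h1, ← Finset.erase_insert h2, hEq']



/-- The arithmetic of the deficit: from `iu·c = ip·b + S` and `a·c = d·b` (`c, d > 0`),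
`iu − (a/d)·ip = S/c`. -/
lemma deficit_arith {iu ip S a b c d : ℚ} (hc : 0 < c) (hd : 0 < d) (h1 : iu * c = ip * b + S)
    (h2 : a * c = d * b) : iu - a / d * ip = S / c := by
  have h3 : a / d = b / c := by
    rw [div_eq_div_iff hd.ne' hc.ne']
    linarith
  rw [h3, eq_div_iff hc.ne']
  field_simp
  linear_combination h1

/-- **Theorem (a_p), termwise**: for a non-loop `e` and `1 ≤ u ≤ p ≤ |E|`, the LYM-deficit of the independence
complex of `M` at level `u` (top `p`) dominates the deficit of `M ／ {e}` at level `u − 1` (top `p − 1`):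
`i_{u−1}(M／e) − C(n−1,u−1)/C(n−1,p−1)·i_{p−1}(M／e) ≤ i_u(M) − C(n,u)/C(n,p)·i_p(M)`.  The difference is
`Σ_{Z ∈ I_u(M), e ∉ Z} dep_p(Z) / C(n−u, p−u) ≥ 0`. -/
theorem deficit_contract_le {e : α} (he : M.IsNonloop e) {u p : ℕ} (hu : 1 ≤ u) (hup : u ≤ p)
    (hpn : p ≤ M.E.ncard) :
    ((indepSets (M ／ {e}) (u - 1)).card : ℚ) -
        ((M.E.ncard - 1).choose (u - 1) : ℚ) / ((M.E.ncard - 1).choose (p - 1) : ℚ) *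
          (indepSets (M ／ {e}) (p - 1)).card ≤
      ((indepSets M u).card : ℚ) -
        (M.E.ncard.choose u : ℚ) / (M.E.ncard.choose p : ℚ) * (indepSets M p).card := by
  set n := M.E.ncard with hn
  have hn' : (M ／ {e}).E.ncard = n - 1 := by
    rw [Matroid.contract_ground, Set.ncard_sdiff_singleton_of_mem he.mem_ground]
  -- Lemma 1 for `M` at `(u, p)` and for `M ／ {e}` at `(u − 1, p − 1)`
  have hM := card_indepSets_mul_choose_add_sum_depCount M hup
  have hC := card_indepSets_mul_choose_add_sum_depCount (M ／ {e}) (u := u - 1) (p := p - 1) (by omega)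
  rw [hn'] at hC
  have hsame : (n - 1 - (u - 1)).choose (p - 1 - (u - 1)) = (n - u).choose (p - u) := by
    congr 1 <;> omega
  rw [hsame] at hC
  -- the contraction transfer bounds the sum for `M` from below
  obtain ⟨v, rfl⟩ : ∃ v, u = v + 1 := ⟨u - 1, by omega⟩
  obtain ⟨r, rfl⟩ : ∃ r, p = r + 1 := ⟨p - 1, by omega⟩
  simp only [Nat.add_sub_cancel] at hC ⊢
  have hS : ∑ Z' ∈ indepSets (M ／ {e}) v, depCount (M ／ {e}) r Z' ≤
      ∑ Z ∈ indepSets M (v + 1), depCount M (r + 1) Z := by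
    rw [← sum_depCount_contract M he v r]
    exact Finset.sum_le_sum_of_subset (Finset.filter_subset _ _)
  -- positivity of the binomials
  have hc : (0 : ℚ) < ((n - (v + 1)).choose (r + 1 - (v + 1)) : ℕ) := by
    exact_mod_cast Nat.choose_pos (by omega)
  have hd1 : (0 : ℚ) < (n.choose (r + 1) : ℕ) := by exact_mod_cast Nat.choose_pos hpn
  have hd2 : (0 : ℚ) < ((n - 1).choose r : ℕ) := by exact_mod_cast Nat.choose_pos (by omega)
  -- the two deficits as quotients
  have hA : ((indepSets M (v + 1)).card : ℚ) -
      (n.choose (v + 1) : ℚ) / (n.choose (r + 1) : ℚ) * (indepSets M (r + 1)).card =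
      (∑ Z ∈ indepSets M (v + 1), depCount M (r + 1) Z : ℕ) / ((n - (v + 1)).choose (r + 1 - (v + 1)) : ℕ) := by
    refine deficit_arith (b := ((r + 1).choose (v + 1) : ℕ)) hc hd1 ?_ ?_
    · rw [← hn] at hM
      exact_mod_cast hM
    · have := Nat.choose_mul (n := n) (k := r + 1) (s := v + 1) hup
      exact_mod_cast this.symm
  have hB : ((indepSets (M ／ {e}) v).card : ℚ) -
      ((n - 1).choose v : ℚ) / ((n - 1).choose r : ℚ) * (indepSets (M ／ {e}) r).card =
      (∑ Z' ∈ indepSets (M ／ {e}) v, depCount (M ／ {e}) r Z' : ℕ) /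
        ((n - (v + 1)).choose (r + 1 - (v + 1)) : ℕ) := by
    refine deficit_arith (b := (r.choose v : ℕ)) hc hd2 ?_ ?_
    · exact_mod_cast hC
    · have := Nat.choose_mul (n := n - 1) (k := r) (s := v) (by omega)
      have hsame2 : (n - 1 - v).choose (r - v) = (n - (v + 1)).choose (r + 1 - (v + 1)) := by
        congr 1 <;> omega
      rw [hsame2] at this
      exact_mod_cast this.symm
  rw [hA, hB]
  apply div_le_div_of_nonneg_right _ hc.le
  exact_mod_cast hS



/-- The PURE INDEPENDENT-SET SLACK `τ′_M(p, q) = Σ_{q<u<p} (i_u − C(n,u)/C(n,p)·i_p)`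
(`= Σ_{q<u<p} i_u − Φ_n(p,q)·i_p`; at `n = p + q` the weight is `Φ(p, q)`; on the tight layer `τ′ ≤ σ`). -/
noncomputable def indepSlack (p q : ℕ) : ℚ :=
  ∑ u ∈ Finset.Ioo q p, (((indepSets M u).card : ℚ) -
    (M.E.ncard.choose u : ℚ) / (M.E.ncard.choose p : ℚ) * (indepSets M p).card)

/-- One deficit is nonnegative (the hereditary bound, p3's `choose_mul_card_indepSets_le`). -/
lemma deficit_nonneg {u p : ℕ} (hup : u ≤ p) (hpn : p ≤ M.E.ncard) :
    0 ≤ ((indepSets M u).card : ℚ) -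
      (M.E.ncard.choose u : ℚ) / (M.E.ncard.choose p : ℚ) * (indepSets M p).card := by
  have h := choose_mul_card_indepSets_le M p hup hpn
  have hd : (0 : ℚ) < (M.E.ncard.choose p : ℕ) := by exact_mod_cast Nat.choose_pos hpn
  rw [sub_nonneg, div_mul_eq_mul_div, div_le_iff₀ hd]
  exact_mod_cast (by linarith [h] : M.E.ncard.choose u * (indepSets M p).card ≤
    (indepSets M u).card * M.E.ncard.choose p)

/-- **Theorem (a_p)**: for a non-loop `e` and `q + 2 ≤ p ≤ |E|`, `τ′_{M／e}(p − 1, q) ≤ τ′_M(p, q)` —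
the contraction monotonicity of the pure independent-set slack, at every non-loop of every finite matroid. -/
theorem indepSlack_contract_le {e : α} (he : M.IsNonloop e) {p q : ℕ} (hpq : q + 2 ≤ p)
    (hpn : p ≤ M.E.ncard) : indepSlack (M ／ {e}) (p - 1) q ≤ indepSlack M p q := by
  have hn' : (M ／ {e}).E.ncard = M.E.ncard - 1 := by
    rw [Matroid.contract_ground, Set.ncard_sdiff_singleton_of_mem he.mem_ground]
  unfold indepSlack
  rw [hn']
  -- the sum over `q < u < p` of the `M`-deficits dominates the sum of the `M／e`-deficits at `u − 1`
  have hterm : ∑ u ∈ Finset.Ioo q p, (((indepSets (M ／ {e}) (u - 1)).card : ℚ) -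
      ((M.E.ncard - 1).choose (u - 1) : ℚ) / ((M.E.ncard - 1).choose (p - 1) : ℚ) *
        (indepSets (M ／ {e}) (p - 1)).card) ≤
      ∑ u ∈ Finset.Ioo q p, (((indepSets M u).card : ℚ) -
        (M.E.ncard.choose u : ℚ) / (M.E.ncard.choose p : ℚ) * (indepSets M p).card) := by
    apply Finset.sum_le_sum
    intro u hu
    rw [Finset.mem_Ioo] at hu
    exact deficit_contract_le M he (by omega) (by omega) hpn
  refine le_trans ?_ hterm
  -- reindex: `Σ_{u ∈ Ioo q p} f(u − 1) = f(q) + Σ_{v ∈ Ioo q (p−1)} f(v)`, and `f(q) ≥ 0`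
  have hre : ∑ u ∈ Finset.Ioo q p, (((indepSets (M ／ {e}) (u - 1)).card : ℚ) -
      ((M.E.ncard - 1).choose (u - 1) : ℚ) / ((M.E.ncard - 1).choose (p - 1) : ℚ) *
        (indepSets (M ／ {e}) (p - 1)).card) =
      ∑ v ∈ Finset.Ico q (p - 1), (((indepSets (M ／ {e}) v).card : ℚ) -
      ((M.E.ncard - 1).choose v : ℚ) / ((M.E.ncard - 1).choose (p - 1) : ℚ) *
        (indepSets (M ／ {e}) (p - 1)).card) := by
    refine Finset.sum_nbij' (fun u => u - 1) (fun v => v + 1) ?_ ?_ ?_ ?_ ?_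
    · intro u hu; simp only [Finset.mem_Ioo, Finset.mem_Ico] at hu ⊢; omega
    · intro v hv; simp only [Finset.mem_Ioo, Finset.mem_Ico] at hv ⊢; omega
    · intro u hu; simp only [Finset.mem_Ioo] at hu; omega
    · intro v _; rfl
    · intro u _; rfl
  rw [hre]
  have hsplit : Finset.Ico q (p - 1) = insert q (Finset.Ioo q (p - 1)) := by
    ext x; simp only [Finset.mem_Ico, Finset.mem_insert, Finset.mem_Ioo]; omega
  rw [hsplit, Finset.sum_insert (by simp)]
  have hq : 0 ≤ ((indepSets (M ／ {e}) q).card : ℚ) -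
      ((M.E.ncard - 1).choose q : ℚ) / ((M.E.ncard - 1).choose (p - 1) : ℚ) *
        (indepSets (M ／ {e}) (p - 1)).card := by
    have := deficit_nonneg (M ／ {e}) (u := q) (p := p - 1) (by omega) (by rw [hn']; omega)
    rwa [hn'] at this
  linarith

end PercRepro
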